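import Literature.NumberTheory.Transcendental.KZSemiCanonicalReductionProofs
import Summits.KontsevichZagierPeriods.KontsevichZagierPeriods.Theorems.ValuedFieldSpecialisationCTConstructionSplitTyped

/-!
# Route ValuedFieldSpecialisation — crux `ParametricLifting`: the escaping-mass family

Helper toward crux stmt-KontsevichZagierPeriods-3498 (`ParametricLifting`), line `registered`,
stub `exists_escapingFamily` of the lead's TIGHTNESS lemmas (clause (1), domination, of
`KZ.IsDominatedFamily` is load-bearing). In coordinates `z 0 = s` (the parameter), `z 1 = u`, the
**escaping-mass family** is `E = ({(s, u) | 0 < u < s < 1}, 1 / s)`: every slice over `0 < s < 1`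
has value `1`, but the special fibre at `s → 0⁺` is a.e. empty and there is no integrable envelope.
Here we CONSTRUCT `E : KZ.IntegralRep 2` together with the unit interval `c = ((0, 1), 1)` and
prove that `E` is fibred-equivalent to the cylinder `c.cylinder = ((0, 1) × (0, 1), 1)` of `c`:
the shear `Ψ z = update z 1 (z 1 * z 0)` (`u = s η`, fixing `z 0`, injective on `{0 < z 0}`,
Jacobian `z 0`) is a FIBRED change of variables from `c.cylinder` onto `E`, since
`1 = (z 0)⁻¹ * |z 0|` on the source; so `[E] - [c.cylinder] ∈ KZ.fibredRelations`.
Integrability of `1 / s` on `E.domain` is transported from that of `1` on the unit square by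
`MeasureTheory.integrableOn_image_iff_integrableOn_abs_det_fderiv_smul`.

Sources: M. Kontsevich, D. Zagier, *Periods* (2001), §1.2 (rule (2)); J. Bochnak, M. Coste,
M.-F. Roy, *Real Algebraic Geometry* (1998), §2.2. No new definitions.
-/

noncomputable section

namespace Summit.KontsevichZagierPeriods.ValuedFieldSpecialisation

open MeasureTheory Set Filter MvPolynomial
open Literature.NumberTheory.Transcendental Literature.NumberTheory.Transcendental.KZ
open Literature.ModelTheory.ExponentialFields (IsSemialgebraic isSemialgebraic_setOf_eval_pos
  isSemialgebraic_setOf_eval_lt)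

/-- An open box `{x | ∀ i, 0 < x i < 1} = (0, 1)ᵐ` has finite Lebesgue volume, and so has every
subset of it. [folklore] -/
theorem volume_ne_top_of_subset_unitBox {m : ℕ} {σ : Set (Fin m → ℝ)}
    (h : ∀ x ∈ σ, ∀ i, 0 < x i ∧ x i < 1) : volume σ ≠ ⊤ := by
  have hsub : σ ⊆ Set.pi univ fun _ : Fin m => Ioo (0 : ℝ) 1 := fun x hx =>
    mem_univ_pi.mpr fun i => h x hx i
  refine ne_top_of_le_ne_top ?_ (measure_mono hsub)
  rw [volume_pi_pi]
  simp

/-- **The unit interval** `c = ((0, 1), 1)` as an integral representation in dimension `1`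
(`KZ.exists_oneRep`). [Kontsevich–Zagier 2001, §1.1] [folklore] -/
theorem exists_unitIntervalRep :
    ∃ c : IntegralRep 1, c.domain = {x | 0 < x 0 ∧ x 0 < 1} ∧ c.integrand = fun _ => 1 := by
  have h0 : IsSemialgebraic ℚ {x : Fin 1 → ℝ | 0 < x 0} := by
    simpa using isSemialgebraic_setOf_eval_pos (k := ℚ) (R := ℝ) (X (0 : Fin 1))
  have h1 : IsSemialgebraic ℚ {x : Fin 1 → ℝ | x 0 < 1} := by
    simpa using isSemialgebraic_setOf_eval_lt (k := ℚ) (R := ℝ) (X (0 : Fin 1)) 1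
  have hσ : IsSemialgebraic ℚ {x : Fin 1 → ℝ | 0 < x 0 ∧ x 0 < 1} := by
    rw [setOf_and]
    exact h0.inter h1
  refine exists_oneRep hσ (volume_ne_top_of_subset_unitBox fun x hx i => ?_)
  rw [Fin.fin_one_eq_zero i]
  exact hx

/-- **Stub `exists_escapingFamily`.** There are representations `c : KZ.IntegralRep 1`, the unit
interval `((0, 1), 1)`, and `E : KZ.IntegralRep 2`, the ESCAPING-MASS family
`({(s, u) | 0 < u < s < 1}, 1 / s)`, with `[E] - [c.cylinder] ∈ KZ.fibredRelations`: the shear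
`Ψ z = update z 1 (z 1 * z 0)` is a fibred change of variables (polynomial, `Ψ z 0 = z 0`,
injective on `{0 < z 0}`, Jacobian `z 0 > 0`) from the cylinder `((0, 1) × (0, 1), 1)` onto `E`,
the integrands matching as `1 = (z 0)⁻¹ * |z 0|`; `E` is integrable by the change-of-variables
formula. [Kontsevich–Zagier 2001, §1.2 rule (2)] [folklore] -/
theorem exists_escapingFamily : ∃ (c : KZ.IntegralRep 1) (E : KZ.IntegralRep 2), c.domain = {x | 0 < x 0 ∧ x 0 < 1} ∧ (c.integrand = fun _ => 1) ∧ E.domain = {z | 0 < z 0 ∧ z 0 < 1 ∧ 0 < z 1 ∧ z 1 < z 0} ∧ (E.integrand = fun z => (z 0)⁻¹) ∧ KZ.of E - KZ.of c.cylinder ∈ KZ.fibredRelations := by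
  obtain ⟨c, hcd, hci⟩ := exists_unitIntervalRep
  have h10 : (1 : Fin 2) ≠ 0 := one_ne_zero
  obtain ⟨Φ', hderiv, hdet⟩ := shear_data (N := 1) 1 h10
  -- the source: the cylinder `(0, 1) × (0, 1)` of `c`, integrand `1`
  have hcyl : ∀ z : Fin 2 → ℝ, z ∈ c.cylinder.domain ↔ 0 < z 0 ∧ z 0 < 1 ∧ 0 < z 1 ∧ z 1 < 1 := by
    intro z
    simp [IntegralRep.cylinderDomain, hcd]
  have hmeas : MeasurableSet c.cylinder.domain := IntegralRep.measurableSet_domain_holds _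
  have hpos : ∀ z ∈ c.cylinder.domain, 0 < z 0 := fun z hz => ((hcyl z).mp hz).1
  have hΨ0 : ∀ z : Fin 2 → ℝ, Function.update z 1 (z 1 * z 0) 0 = z 0 := fun z =>
    Function.update_of_ne h10.symm _ _
  have hΨ1 : ∀ z : Fin 2 → ℝ, Function.update z 1 (z 1 * z 0) 1 = z 1 * z 0 := fun z =>
    Function.update_self _ _ _
  -- the target domain `{0 < u < s < 1}`
  set D : Set (Fin 2 → ℝ) := {z | 0 < z 0 ∧ z 0 < 1 ∧ 0 < z 1 ∧ z 1 < z 0} with hD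
  have hsa : IsSemialgebraic ℚ D := by
    have ha : IsSemialgebraic ℚ {z : Fin 2 → ℝ | 0 < z 0} := by
      simpa using isSemialgebraic_setOf_eval_pos (k := ℚ) (R := ℝ) (X (0 : Fin 2))
    have hb : IsSemialgebraic ℚ {z : Fin 2 → ℝ | z 0 < 1} := by
      simpa using isSemialgebraic_setOf_eval_lt (k := ℚ) (R := ℝ) (X (0 : Fin 2)) 1
    have hc' : IsSemialgebraic ℚ {z : Fin 2 → ℝ | 0 < z 1} := by
      simpa using isSemialgebraic_setOf_eval_pos (k := ℚ) (R := ℝ) (X (1 : Fin 2))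
    have hd : IsSemialgebraic ℚ {z : Fin 2 → ℝ | z 1 < z 0} := by
      simpa using isSemialgebraic_setOf_eval_lt (k := ℚ) (R := ℝ) (X (1 : Fin 2)) (X 0)
    convert ((ha.inter hb).inter hc').inter hd using 1
    ext z
    simp only [hD, mem_setOf_eq, mem_inter_iff, and_assoc]
  -- `Ψ` is injective on the source and maps it onto `D`
  have hinj : InjOn (fun z : Fin 2 → ℝ => Function.update z 1 (z 1 * z 0)) c.cylinder.domain := by
    intro z₁ _ z₂ hz₂ h
    have h0' : z₁ 0 = z₂ 0 := by simpa only [hΨ0] using congrFun h 0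
    refine funext fun k => ?_
    rcases eq_or_ne k 1 with rfl | hk
    · refine mul_right_cancel₀ (hpos _ hz₂).ne' ?_
      simpa only [Function.update_self, h0'] using congrFun h 1
    · simpa only [Function.update_of_ne hk] using congrFun h k
  have himg : (fun z : Fin 2 → ℝ => Function.update z 1 (z 1 * z 0)) '' c.cylinder.domain = D := by
    refine subset_antisymm (image_subset_iff.mpr fun z hz => ?_) fun y hy => ?_
    · obtain ⟨hz0, hz0', hz1, hz1'⟩ := (hcyl z).mp hz
      show Function.update z 1 (z 1 * z 0) ∈ D
      rw [hD, mem_setOf_eq, hΨ0, hΨ1]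
      exact ⟨hz0, hz0', mul_pos hz1 hz0, mul_lt_of_lt_one_left hz0 hz1'⟩
    · obtain ⟨hy0, hy0', hy1, hy1'⟩ := hy
      have hback : Function.update (Function.update y 1 (y 1 / y 0)) 1
          (Function.update y 1 (y 1 / y 0) 1 * Function.update y 1 (y 1 / y 0) 0) = y := by
        rw [Function.update_self, Function.update_of_ne h10.symm, Function.update_idem,
          div_mul_cancel₀ _ hy0.ne', Function.update_eq_self]
      refine ⟨Function.update y 1 (y 1 / y 0), (hcyl _).mpr ?_, hback⟩
      rw [Function.update_self, Function.update_of_ne h10.symm]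
      exact ⟨hy0, hy0', div_pos hy1 hy0, (div_lt_one hy0).mpr hy1'⟩
  -- the target integrand `1 / s` is semialgebraic and integrable on `D`
  have hfi : IsSemialgebraicFunOn ℚ D (fun z : Fin 2 → ℝ => (z 0)⁻¹) :=
    (isSemialgebraicFunOn_aeval_div_aeval hsa 1 (X 0) fun z hz => by
      simpa using hz.1.ne').congr fun z _ => by simp
  have hint : IntegrableOn (fun z : Fin 2 → ℝ => (z 0)⁻¹) D volume := by
    rw [← himg]
    refine (integrableOn_image_iff_integrableOn_abs_det_fderiv_smul volume hmeas
      (fun x _ => (hderiv x).hasFDerivWithinAt) hinj (fun z : Fin 2 → ℝ => (z 0)⁻¹)).mpr ?_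
    have hfin : volume c.cylinder.domain ≠ ⊤ := by
      refine volume_ne_top_of_subset_unitBox fun z hz i => ?_
      obtain ⟨hz0, hz0', hz1, hz1'⟩ := (hcyl z).mp hz
      fin_cases i
      · exact ⟨hz0, hz0'⟩
      · exact ⟨hz1, hz1'⟩
    refine (integrableOn_const hfin (C := (1 : ℝ))).congr_fun (fun z hz => ?_) hmeas
    dsimp only
    rw [smul_eq_mul, hdet, hΨ0, abs_of_pos (hpos z hz), mul_inv_cancel₀ (hpos z hz).ne']
  refine ⟨c, ⟨D, fun z => (z 0)⁻¹, hsa, hfi, hint⟩, hcd, hci, rfl, rfl, ?_⟩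
  -- `Ψ` is a fibred change of variables from `c.cylinder` onto `E`
  have hcov : of c.cylinder - of (⟨D, fun z => (z 0)⁻¹, hsa, hfi, hint⟩ : IntegralRep 2) ∈
      fibredChangeOfVariablesRel :=
    of_sub_of_mem_fibredChangeOfVariablesRel
      (Φ := fun z : Fin 2 → ℝ => Function.update z 1 (z 1 * z 0)) (Φ' := Φ')
      (isSemialgebraicMapOn_shear c.cylinder.isSemialgebraic_domain 1)
      (fun x _ => (hderiv x).hasFDerivWithinAt) hinj himg.symm
      (fun x hx => by
        dsimp only
        rw [IntegralRep.integrand_cylinder, hci, hdet, hΨ0, abs_of_pos (hpos x hx),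
          inv_mul_cancel₀ (hpos x hx).ne'])
      (fun x _ => hΨ0 x)
  simpa only [neg_sub] using
    fibredRelations.neg_mem (mem_fibredRelations_of_mem_fibredChangeOfVariablesRel hcov)

end Summit.KontsevichZagierPeriods.ValuedFieldSpecialisation
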